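import Mathlib
import Summits.Ventures.PercRepro2.CrossAPrimeCoinMark

/-!
# The coin at a mark, III: `CROSS` is four payments minus the debt `P⁰(Q, bH, o ∈ A, vL)`
(blind cell PercRepro2, p5 g39; `proofs/subclaims/S4-HARDSTEP.md` §2.4 (s) addendum 50)

Along the coin `e = {a₂, o}` (closed-coin law `p⁰`, `K = C(a₂)`, `A = C(a₁)`, `Q = {a₁ ∉ K}`), the
growth term `CROSS` of `CrossAPrimeCoinMarkSplit.coin_mark_mid_eq` has ONE negative piece.  Split
`yv⁰ = P⁰(Q, vL, bH)` by whether `o ∈ K` and, if not, whether `o ∈ A`: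

  `yv⁰ = Dv⁰ + debt + r₁`,  `debt := P⁰(Q, vL, bH, a₁ ↔ o)`,  `r₁ := P⁰(Q, vL, bH, o ∉ K, o ∉ A)`

(`yv0_split`), and split the type-2 mass `yv₂′ = P¹(Q, vL, bH, type 2)` by whether `b ∈ K⁰`:
`yv₂′ = r₁ + r₂` (`yv2_split`; the flip of the coin identifies `r₁` with the `p¹`-mass
`P¹(Q, vL, bH, type 2, b ∈ K⁰)`, `flip_type2_bK`).  With `Z₂′ ≤ Z⁰ − x⁰` (`Z2_le`) this gives

  `CROSS = y₂′(c·x⁰ − xv⁰) + [y⁰(c·Z₂′ − Zv₂′) + Z⁰·yv₂′ − Z₂′·debt]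
           + Z₂′·Dv⁰ + r₁·(Z⁰ − x⁰ − Z₂′) + r₂·(Z⁰ − x⁰)`,

every bracket but the second nonnegative (admissibility for the first).  Hence the growth term —
and with it the open step of the `a₂`-side induction at the mark `o` — follows from the single
DEBT BOUND

  **(D1b)**  `Z₂′ · P⁰(Q, bH, o ∈ A, vL) ≤ y⁰ · (c·Z₂′ − Zv₂′) + Z⁰ · yv₂′`

(**`cross_nonneg_of_debt_bound`**, **`a2Step_coin_mark_of_debt_bound`**).  (D1b) is census-true
(0 / 500 exact instances, own code) and is NOT claimed here; its `c`-free strengthening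
`(D1b′)` and the one-measure inequality `(E1)` behind it are the subject of the sequel.
Own work; standard axioms.
-/

namespace Summit.Ventures.PercRepro2

open LeafRowPendantRootSO CrossAPrimeSupport CrossAPrimeA2Route CrossAPrimeA2Induction
  CrossAPrimeExploredBound CrossAPrimeA2VEdge CrossAPrimeCoinMark

namespace CrossAPrimeCoinMarkDebt

section Flip

variable {V : Type*} {E : Type*} [DecidableEq E] {ends : E → Sym2 V}

/-- **Opening the coin `e = {a₂, o}`, one step**: `s ↔ x` in `ω[e ↦ open]` iff `s ↔ x`, or
`s ↔ a₂ ∧ o ↔ x`, or `s ↔ o ∧ a₂ ↔ x`, all in `ω[e ↦ closed]`. -/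
lemma conn_flip_iff {e : E} {a₂ o : V} (hends : ends e = s(a₂, o)) (ω : Config E) (s x : V) :
    Conn ends (Function.update ω e true) s x ↔
      Conn ends (Function.update ω e false) s x ∨
        (Conn ends (Function.update ω e false) s a₂ ∧ Conn ends (Function.update ω e false) o x) ∨
        (Conn ends (Function.update ω e false) s o ∧ Conn ends (Function.update ω e false) a₂ x) := by
  have h := OneEdge.conn_update_true_iff hends (Function.update ω e false) s x
  rwa [Function.update_idem] at h

/-- **The flip correspondence for the `b ∈ K⁰` part of type 2**: for `e = {a₂, o}`,
`ω[e ↦ open] ∈ Q ∩ vL ∩ bH` with `o ∉ K⁰` and `b ∈ K⁰` iff `ω[e ↦ closed] ∈ Q ∩ vL ∩ bH` with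
`o ∉ K⁰` and `o ∉ A⁰`. -/
lemma flip_type2_bK {e : E} {a₂ o : V} (hends : ends e = s(a₂, o)) (a₁ v b : V) (ω : Config E) :
    (Function.update ω e true ∈
          avoidAll ends a₂ {a₁} ∩ (connEvent ends a₁ v ∩ connEvent ends a₂ b) ∧
        ¬ Conn ends (Function.update ω e false) a₂ o ∧
        Conn ends (Function.update ω e false) a₂ b) ↔
      (Function.update ω e false ∈
          avoidAll ends a₂ {a₁} ∩ (connEvent ends a₁ v ∩ connEvent ends a₂ b) ∧
        ¬ Conn ends (Function.update ω e false) a₂ o ∧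
        ¬ Conn ends (Function.update ω e false) a₁ o) := by
  simp only [Set.mem_inter_iff, mem_avoidAll, Finset.mem_singleton, forall_eq, connEvent,
    Set.mem_setOf_eq, conn_flip_iff hends]
  constructor
  · rintro ⟨⟨hQ, hv, -⟩, ho, hb⟩
    refine ⟨⟨?_, ?_, hb⟩, ho, ?_⟩
    · exact fun h => hQ (Or.inl h)
    · rcases hv with hv | ⟨h1, -⟩ | ⟨h1, -⟩
      · exact hv
      · exact absurd (conn_symm h1) (fun h => hQ (Or.inl h))
      · exact absurd (conn_symm h1) (fun h => hQ (Or.inr (Or.inl ⟨conn_refl _ _ _, h⟩)))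
    · exact fun h => hQ (Or.inr (Or.inl ⟨conn_refl _ _ _, conn_symm h⟩))
  · rintro ⟨⟨hQ, hv, hb⟩, ho, hao⟩
    refine ⟨⟨?_, Or.inl hv, Or.inl hb⟩, ho, hb⟩
    rintro (h | ⟨-, h⟩ | ⟨h, -⟩)
    · exact hQ h
    · exact hao (conn_symm h)
    · exact ho h

/-- **The flip correspondence for the `Q`-mass of type 2**: `ω[e ↦ open] ∈ Q` with `o ∉ K⁰` iff
`ω[e ↦ closed] ∈ Q` with `o ∉ K⁰` and `o ∉ A⁰`. -/
lemma flip_type2_Q {e : E} {a₂ o : V} (hends : ends e = s(a₂, o)) (a₁ : V) (ω : Config E) :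
    (Function.update ω e true ∈ avoidAll ends a₂ {a₁} ∧
        ¬ Conn ends (Function.update ω e false) a₂ o) ↔
      (Function.update ω e false ∈ avoidAll ends a₂ {a₁} ∧
        ¬ Conn ends (Function.update ω e false) a₂ o ∧
        ¬ Conn ends (Function.update ω e false) a₁ o) := by
  simp only [mem_avoidAll, Finset.mem_singleton, forall_eq, conn_flip_iff hends]
  constructor
  · rintro ⟨hQ, ho⟩
    exact ⟨fun h => hQ (Or.inl h), ho,
      fun h => hQ (Or.inr (Or.inl ⟨conn_refl _ _ _, conn_symm h⟩))⟩
  · rintro ⟨hQ, ho, hao⟩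
    refine ⟨?_, ho⟩
    rintro (h | ⟨-, h⟩ | ⟨h, -⟩)
    · exact hQ h
    · exact hao (conn_symm h)
    · exact ho h

end Flip

section Splits

variable {V : Type*} {E : Type*} [Fintype E] [DecidableEq E] {R : Type*} [Field R]
variable {ends : E → Sym2 V}

omit [Fintype E] [DecidableEq E] in
/-- Under `Q`, `o ∈ A` forces `o ∉ K`. -/
lemma inter_connEvent_a1o_eq (a₁ a₂ o : V) (S : Set (Config E)) :
    (avoidAll ends a₂ {a₁} ∩ S) ∩ (connEvent ends a₂ o)ᶜ ∩ connEvent ends a₁ o =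
      (avoidAll ends a₂ {a₁} ∩ S) ∩ connEvent ends a₁ o := by
  ext ω
  simp only [Set.mem_inter_iff, Set.mem_compl_iff, mem_avoidAll, Finset.mem_singleton, forall_eq,
    connEvent, Set.mem_setOf_eq]
  constructor
  · rintro ⟨⟨⟨hQ, hS⟩, -⟩, h⟩
    exact ⟨⟨hQ, hS⟩, h⟩
  · rintro ⟨⟨hQ, hS⟩, h⟩
    exact ⟨⟨⟨hQ, hS⟩, fun h' => hQ (conn_trans h' (conn_symm h))⟩, h⟩

/-- **The split of `yv⁰`**: `yv⁰ = Dv⁰ + debt + r₁` with `debt = P⁰(Q, vL, bH, a₁ ↔ o)` and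
`r₁ = P⁰(Q, vL, bH, o ∉ K, o ∉ A)`. -/
lemma yv0_split (p : E → R) (a₁ a₂ o v b : V) :
    prob p (avoidAll ends a₂ {a₁} ∩ (connEvent ends a₁ v ∩ connEvent ends a₂ b)) =
      prob p (avoidAll ends a₂ {a₁} ∩
          (connEvent ends a₁ v ∩ (connEvent ends a₂ o ∩ connEvent ends a₂ b))) +
        prob p ((avoidAll ends a₂ {a₁} ∩ (connEvent ends a₁ v ∩ connEvent ends a₂ b)) ∩
          connEvent ends a₁ o) +
        prob p ((avoidAll ends a₂ {a₁} ∩ (connEvent ends a₁ v ∩ connEvent ends a₂ b)) ∩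
          (connEvent ends a₂ o)ᶜ ∩ (connEvent ends a₁ o)ᶜ) := by
  have h1 := prob_inter_add_prob_inter_compl p
    (avoidAll ends a₂ {a₁} ∩ (connEvent ends a₁ v ∩ connEvent ends a₂ b)) (connEvent ends a₂ o)
  have h2 := prob_inter_add_prob_inter_compl p
    ((avoidAll ends a₂ {a₁} ∩ (connEvent ends a₁ v ∩ connEvent ends a₂ b)) ∩
      (connEvent ends a₂ o)ᶜ) (connEvent ends a₁ o)
  rw [inter_connEvent_a1o_eq] at h2
  have e1 : avoidAll ends a₂ {a₁} ∩ (connEvent ends a₁ v ∩ connEvent ends a₂ b) ∩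
      connEvent ends a₂ o = avoidAll ends a₂ {a₁} ∩
        (connEvent ends a₁ v ∩ (connEvent ends a₂ o ∩ connEvent ends a₂ b)) := by
    ext ω
    simp only [Set.mem_inter_iff]
    tauto
  rw [e1] at h1
  linear_combination -h1 - h2

/-- **`r₁` as a `p¹`-mass**: `P¹(Q, vL, bH, type 2, b ∈ K⁰) = P⁰(Q, vL, bH, o ∉ K, o ∉ A)`. -/
lemma r1_eq (p : E → R) {e : E} {a₂ o : V} (hends : ends e = s(a₂, o)) (a₁ v b : V) :
    prob (Function.update p e 1)
        (((avoidAll ends a₂ {a₁} ∩ (connEvent ends a₁ v ∩ connEvent ends a₂ b)) ∩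
            {ω | o ∉ cluster ends (Function.update ω e false) a₂}) ∩
          {ω | Conn ends (Function.update ω e false) a₂ b}) =
      prob (Function.update p e 0)
        ((avoidAll ends a₂ {a₁} ∩ (connEvent ends a₁ v ∩ connEvent ends a₂ b)) ∩
          (connEvent ends a₂ o)ᶜ ∩ (connEvent ends a₁ o)ᶜ) := by
  rw [RBRootEdge.prob_update_one_eq, RBRootEdge.prob_update_zero_eq]
  congr 1
  ext ω
  simp only [Set.mem_setOf_eq, Set.mem_inter_iff, Function.update_idem, mem_cluster]
  have h := flip_type2_bK hends a₁ v b ω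
  simp only [Set.mem_inter_iff] at h
  constructor
  · rintro ⟨⟨hX, ho⟩, hb⟩
    obtain ⟨hX', ho', hao'⟩ := h.1 ⟨hX, ho, hb⟩
    exact ⟨⟨hX', ho'⟩, hao'⟩
  · rintro ⟨⟨hX, ho⟩, hao⟩
    obtain ⟨hX', ho', hb'⟩ := h.2 ⟨hX, ho, hao⟩
    exact ⟨⟨hX', ho'⟩, hb'⟩

/-- **The split of `yv₂′`** by whether `b ∈ K⁰`: `yv₂′ = r₁ + r₂`. -/
lemma yv2_split (p : E → R) (e : E) (a₁ a₂ o v b : V) :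
    prob (Function.update p e 1)
        ((avoidAll ends a₂ {a₁} ∩ (connEvent ends a₁ v ∩ connEvent ends a₂ b)) ∩
          {ω | o ∉ cluster ends (Function.update ω e false) a₂}) =
      prob (Function.update p e 1)
          (((avoidAll ends a₂ {a₁} ∩ (connEvent ends a₁ v ∩ connEvent ends a₂ b)) ∩
              {ω | o ∉ cluster ends (Function.update ω e false) a₂}) ∩
            {ω | Conn ends (Function.update ω e false) a₂ b}) +
        prob (Function.update p e 1)
          (((avoidAll ends a₂ {a₁} ∩ (connEvent ends a₁ v ∩ connEvent ends a₂ b)) ∩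
              {ω | o ∉ cluster ends (Function.update ω e false) a₂}) ∩
            {ω | Conn ends (Function.update ω e false) a₂ b}ᶜ) :=
  (prob_inter_add_prob_inter_compl _ _ _).symm

end Splits

section Bound

variable {V : Type*} {E : Type*} [Fintype E] [DecidableEq E] {R : Type*} [Field R]
  [LinearOrder R] [IsStrictOrderedRing R]
variable {ends : E → Sym2 V}

/-- **`Z₂′ ≤ Z⁰ − x⁰`**: the type-2 `Q`-mass is at most `P⁰(Q, o ∉ K)`. -/
lemma Z2_le {p : E → R} (hp : IsProbVec p) {e : E} {a₂ o : V} (hends : ends e = s(a₂, o))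
    (a₁ : V) :
    prob (Function.update p e 1)
        (avoidAll ends a₂ {a₁} ∩ {ω | o ∉ cluster ends (Function.update ω e false) a₂}) ≤
      prob (Function.update p e 0) (avoidAll ends a₂ {a₁}) -
        prob (Function.update p e 0) (avoidAll ends a₂ {a₁} ∩ connEvent ends a₂ o) := by
  have hsplit := prob_inter_add_prob_inter_compl (Function.update p e 0)
    (avoidAll ends a₂ {a₁}) (connEvent ends a₂ o)
  have hle : prob (Function.update p e 1)
      (avoidAll ends a₂ {a₁} ∩ {ω | o ∉ cluster ends (Function.update ω e false) a₂}) ≤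
      prob (Function.update p e 0) (avoidAll ends a₂ {a₁} ∩ (connEvent ends a₂ o)ᶜ) := by
    rw [RBRootEdge.prob_update_one_eq, RBRootEdge.prob_update_zero_eq]
    apply prob_mono hp
    intro ω hω
    simp only [Set.mem_setOf_eq, Set.mem_inter_iff, Function.update_idem, mem_cluster] at hω
    obtain ⟨hQ, ho, -⟩ := (flip_type2_Q hends a₁ ω).1 hω
    simp only [Set.mem_setOf_eq, Set.mem_inter_iff, Set.mem_compl_iff, connEvent]
    exact ⟨hQ, ho⟩
  linarith [hsplit, hle]

end Bound

section Main

variable {V : Type*} {E : Type*} [Fintype E] [DecidableEq E] [Fintype V] [DecidableEq V]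
  {R : Type*} [Field R] [LinearOrder R] [IsStrictOrderedRing R]
variable {ends : E → Sym2 V}

omit [DecidableEq V] in
/-- **`CROSS ≥ 0` from the debt bound (D1b)**: along the coin `e = {a₂, o}` (random, `c`
admissible), if `Z₂′ · P⁰(Q, vL, bH, a₁ ↔ o) ≤ y⁰ · (c·Z₂′ − Zv₂′) + Z⁰ · yv₂′`, then the growth
term `CROSS` of `coin_mark_mid_eq` is nonnegative. -/
theorem cross_nonneg_of_debt_bound {p : E → R} (hp : IsProbVec p) {c : R} {a₁ a₂ v : V}
    (hadm : Adm p c ends a₁ a₂ v) {e : E} {o : V} (hends : ends e = s(a₂, o)) (h1 : p e ≠ 1)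
    (b : V)
    (hdebt : prob (Function.update p e 1) (avoidAll ends a₂ {a₁} ∩
          {ω | o ∉ cluster ends (Function.update ω e false) a₂}) *
        prob (Function.update p e 0) ((avoidAll ends a₂ {a₁} ∩
          (connEvent ends a₁ v ∩ connEvent ends a₂ b)) ∩ connEvent ends a₁ o) ≤
      prob (Function.update p e 0) (avoidAll ends a₂ {a₁} ∩ connEvent ends a₂ b) *
          (c * prob (Function.update p e 1) (avoidAll ends a₂ {a₁} ∩
              {ω | o ∉ cluster ends (Function.update ω e false) a₂}) -
            prob (Function.update p e 1) ((avoidAll ends a₂ {a₁} ∩ connEvent ends a₁ v) ∩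
              {ω | o ∉ cluster ends (Function.update ω e false) a₂})) +
        prob (Function.update p e 0) (avoidAll ends a₂ {a₁}) *
          prob (Function.update p e 1)
            ((avoidAll ends a₂ {a₁} ∩ (connEvent ends a₁ v ∩ connEvent ends a₂ b)) ∩
              {ω | o ∉ cluster ends (Function.update ω e false) a₂})) :
    0 ≤
      prob (Function.update p e 1) ((avoidAll ends a₂ {a₁} ∩ connEvent ends a₂ b) ∩
            {ω | o ∉ cluster ends (Function.update ω e false) a₂}) *
          (c * prob (Function.update p e 0) (avoidAll ends a₂ {a₁} ∩ connEvent ends a₂ o) -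
            prob (Function.update p e 0)
              (avoidAll ends a₂ {a₁} ∩ (connEvent ends a₁ v ∩ connEvent ends a₂ o))) +
        prob (Function.update p e 0) (avoidAll ends a₂ {a₁} ∩ connEvent ends a₂ b) *
          (c * prob (Function.update p e 1) (avoidAll ends a₂ {a₁} ∩
              {ω | o ∉ cluster ends (Function.update ω e false) a₂}) -
            prob (Function.update p e 1) ((avoidAll ends a₂ {a₁} ∩ connEvent ends a₁ v) ∩
              {ω | o ∉ cluster ends (Function.update ω e false) a₂})) +
        prob (Function.update p e 1)
            ((avoidAll ends a₂ {a₁} ∩ (connEvent ends a₁ v ∩ connEvent ends a₂ b)) ∩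
              {ω | o ∉ cluster ends (Function.update ω e false) a₂}) *
          (2 * prob (Function.update p e 0) (avoidAll ends a₂ {a₁}) -
            prob (Function.update p e 0) (avoidAll ends a₂ {a₁} ∩ connEvent ends a₂ o)) +
        prob (Function.update p e 1) (avoidAll ends a₂ {a₁} ∩
            {ω | o ∉ cluster ends (Function.update ω e false) a₂}) *
          (2 * prob (Function.update p e 0) (avoidAll ends a₂ {a₁} ∩
              (connEvent ends a₁ v ∩ (connEvent ends a₂ o ∩ connEvent ends a₂ b))) -
            prob (Function.update p e 0)
              (avoidAll ends a₂ {a₁} ∩ (connEvent ends a₁ v ∩ connEvent ends a₂ b))) := by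
  have hp0 : IsProbVec (Function.update p e 0) := hp.update e le_rfl zero_le_one
  have hp1 : IsProbVec (Function.update p e 1) := hp.update e zero_le_one le_rfl
  have hadm0 : Adm (Function.update p e 0) c ends a₁ a₂ v :=
    adm_update_zero hadm ⟨a₂, mem_cluster_self ends _ a₂, o, hends⟩ h1
  -- the admissibility bound `xv⁰ ≤ c·x⁰`
  have hx : prob (Function.update p e 0)
      (avoidAll ends a₂ {a₁} ∩ (connEvent ends a₁ v ∩ connEvent ends a₂ o)) ≤
      c * prob (Function.update p e 0) (avoidAll ends a₂ {a₁} ∩ connEvent ends a₂ o) := by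
    have h := prob_Q_vL_le_mul hp0 hadm0 {A : Set V | o ∈ A}
    rw [← connEvent_eq_clusterInEvent'] at h
    have e1 : connEvent ends a₂ o ∩ connEvent ends a₁ v ∩ avoidAll ends a₂ {a₁} =
        avoidAll ends a₂ {a₁} ∩ (connEvent ends a₁ v ∩ connEvent ends a₂ o) := by
      ext ω; simp only [Set.mem_inter_iff]; tauto
    have e2 : connEvent ends a₂ o ∩ avoidAll ends a₂ {a₁} =
        avoidAll ends a₂ {a₁} ∩ connEvent ends a₂ o := Set.inter_comm _ _
    rw [e1, e2] at h
    exact h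
  -- the two splits and the bound `Z₂′ ≤ Z⁰ − x⁰`
  have s0 := yv0_split (Function.update p e 0) (ends := ends) a₁ a₂ o v b
  have s2 := yv2_split p (ends := ends) e a₁ a₂ o v b
  rw [r1_eq p hends a₁ v b] at s2
  have hZ2 := Z2_le hp hends a₁
  -- nonnegativity of the masses
  have hy2 := prob_nonneg hp1 ((avoidAll ends a₂ {a₁} ∩ connEvent ends a₂ b) ∩
    {ω | o ∉ cluster ends (Function.update ω e false) a₂})
  have hZ2' := prob_nonneg hp1 (avoidAll ends a₂ {a₁} ∩
    {ω | o ∉ cluster ends (Function.update ω e false) a₂})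
  have hDv := prob_nonneg hp0 (avoidAll ends a₂ {a₁} ∩
    (connEvent ends a₁ v ∩ (connEvent ends a₂ o ∩ connEvent ends a₂ b)))
  have hr1 := prob_nonneg hp0 ((avoidAll ends a₂ {a₁} ∩
    (connEvent ends a₁ v ∩ connEvent ends a₂ b)) ∩ (connEvent ends a₂ o)ᶜ ∩ (connEvent ends a₁ o)ᶜ)
  have hr2 := prob_nonneg hp1 (((avoidAll ends a₂ {a₁} ∩
    (connEvent ends a₁ v ∩ connEvent ends a₂ b)) ∩
      {ω | o ∉ cluster ends (Function.update ω e false) a₂}) ∩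
    {ω | Conn ends (Function.update ω e false) a₂ b}ᶜ)
  have hx0 := prob_nonneg hp0 (avoidAll ends a₂ {a₁} ∩ connEvent ends a₂ o)
  have hZx := prob_mono hp0 (Set.inter_subset_left :
    avoidAll ends a₂ {a₁} ∩ connEvent ends a₂ o ⊆ avoidAll ends a₂ {a₁})
  -- the four nonnegative products
  have k1 := mul_nonneg hy2 (sub_nonneg.2 hx)
  have k2 := mul_nonneg hZ2' hDv
  have k3 := mul_nonneg hr1 (sub_nonneg.2 hZ2)
  have k4 := mul_nonneg hr2 (sub_nonneg.2 hZx)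
  nlinarith [k1, k2, k3, k4, hdebt, s0, s2]

omit [DecidableEq V] in
/-- **The coin at a mark from the debt bound**: under the induction hypothesis
`0 ≤ crossC(p⁰; c)` and (D1b), the middle coefficient along `e = {a₂, o}` is nonnegative. -/
theorem a2Step_coin_mark_of_debt_bound {p : E → R} (hp : IsProbVec p) {c : R} {a₁ a₂ v : V}
    (hadm : Adm p c ends a₁ a₂ v) {e : E} {o : V} (hends : ends e = s(a₂, o)) (h1 : p e ≠ 1)
    (b : V) (hIH : 0 ≤ crossC (Function.update p e 0) c ends o a₁ a₂ v b)
    (hdebt : prob (Function.update p e 1) (avoidAll ends a₂ {a₁} ∩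
          {ω | o ∉ cluster ends (Function.update ω e false) a₂}) *
        prob (Function.update p e 0) ((avoidAll ends a₂ {a₁} ∩
          (connEvent ends a₁ v ∩ connEvent ends a₂ b)) ∩ connEvent ends a₁ o) ≤
      prob (Function.update p e 0) (avoidAll ends a₂ {a₁} ∩ connEvent ends a₂ b) *
          (c * prob (Function.update p e 1) (avoidAll ends a₂ {a₁} ∩
              {ω | o ∉ cluster ends (Function.update ω e false) a₂}) -
            prob (Function.update p e 1) ((avoidAll ends a₂ {a₁} ∩ connEvent ends a₁ v) ∩
              {ω | o ∉ cluster ends (Function.update ω e false) a₂})) +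
        prob (Function.update p e 0) (avoidAll ends a₂ {a₁}) *
          prob (Function.update p e 1)
            ((avoidAll ends a₂ {a₁} ∩ (connEvent ends a₁ v ∩ connEvent ends a₂ b)) ∩
              {ω | o ∉ cluster ends (Function.update ω e false) a₂})) :
    0 ≤ crossPatC (Function.update p e 0) (Function.update p e 1) c ends o a₁ a₂ v b +
        crossPatC (Function.update p e 1) (Function.update p e 0) c ends o a₁ a₂ v b :=
  a2Step_coin_mark_of_cross hp hadm hends h1 b hIH
    (cross_nonneg_of_debt_bound hp hadm hends h1 b hdebt)

end Main

end CrossAPrimeCoinMarkDebt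

end Summit.Ventures.PercRepro2
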